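import Summits.ValiantsHypothesis.ValiantsHypothesis.Theorems.RigidityForcesSymmetryGrenetFirstOrderRankRigidOverlapTermFwd
import Summits.ValiantsHypothesis.ValiantsHypothesis.Theorems.RigidityForcesSymmetryGrenetFirstOrderRankRigidOverlapTermBwd

/-!
# Route RigidityForcesSymmetry — `GrenetFirstOrderRankRigid` (item stmt-ValiantsHypothesis-21029),
line `grenet_gauge`: stub `stub_linearRigid`, step 5 (block I>, part 5) — the core identity of an
overlap block at a dominated design

For the crux line `Cruxes/GrenetFirstOrderRankRigid/Lines/grenet_gauge.lean` (blueprint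
`Lines/grenet_gauge-stub_linearRigid-PROOF.md`, §5, type I>; interface
`Lines/grenet_gauge-stub_linearRigid-BLOCKS.md`, deliverable (D-PQ)).

A tail entry `(S, T, (p, |S|))` of a homogeneous, rank-constrained tangent direction at Grenet's pencil
(arc `S → U := S + p`) and its head partner `(U, T + p', (p', |T|))`, `|T| ≤ |S|`, `T ⊄ U`, satisfy
`A'(head) = - A'(tail)` as soon as an OVERLAP DESIGN through them exists: `d₁` injective on the levels
`≤ |S|` with image `U`, `d₁ |S| = p`; `d₂` injective on the levels `≥ |T|` avoiding `T`, `d₂ |T| = p'`;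
dominated forward (`grenet_overlap_PQ_of_design`: every `d₂`-cell of the overlap has its row swept
earlier by `d₁`, every `d₁`-cell has its row in `T` or swept later by `d₂`) or backward
(`grenet_overlap_PQ_of_design'`: every `d₁`-cell swept later by `d₂`, every `d₂`-cell outside `U` or
swept earlier by `d₁`).  Proof: `grenet_overlap_PQ_of_pointEval` with `grenet_overlapTerm_fwd` /
`grenet_overlapTerm_bwd`.  The snake designs of `…BlockIgt` instantiate both.

No new definitions.  VP ≠ VNP is not moved by this file (first-order bookkeeping about one matrix
family).
-/

noncomputable section

open MvPolynomial Matrix Finset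

namespace Summit.ValiantsHypothesis.Theorems.RigidityForcesSymmetry.GrenetGauge

open Literature.Computability.AlgebraicComplexity

section OverlapDesign

variable {k : Type*} [CommRing k] [IsDomain k] {n N : ℕ} (e : Finset (Fin n) ≃ Fin (N + 1))

/-- **The core identity of an overlap block, forward-dominated design** (deliverable (D-PQ), type I>).
Let `(i, j, v)` be a TAIL entry (`v = (p, |S|)`, `p ∉ S = R i`, arc `S → U := S + p`) and `(i', j', v')`
a HEAD entry (`v' = (p', |T|)`, `T = C j = C j' - p'`) of a homogeneous, rank-constrained tangent
direction at Grenet's pencil, of the same pair: `R i' = U`.  Suppose the pair OVERLAPS (`|T| ≤ |S|`)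
with `T ⊄ U`, and let `(d₁, d₂)` be a forward-dominated overlap design through the two entries.  Then
`A'_{v'} i' j' = - A'_v i j`. [cite: Grenet2011, Thm. 1] -/
theorem grenet_overlap_PQ_of_design (hn : n ≠ 0) (hN : 2 ^ n = N + 1)
    (A' : Fin n × Fin n → Matrix (Fin N) (Fin N) k)
    (htr : ((Grenet.repr k n e).adjugate * ∑ v, (X v : MvPolynomial (Fin n × Fin n) k) • (A' v).map C).trace = 0)
    (hsupp : ∀ (w : Fin n × Fin n) (a b : Fin N), A' w a b ≠ 0 →
      (w.1 ∉ e.symm ((e univ).succAbove a) ∧ (w.2 : ℕ) = (e.symm ((e univ).succAbove a)).card) ∨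
      (w.1 ∈ e.symm ((e ∅).succAbove b) ∧ (e.symm ((e ∅).succAbove b)).card = (w.2 : ℕ) + 1))
    {i j : Fin N} {v : Fin n × Fin n} {i' j' : Fin N} {v' : Fin n × Fin n}
    (htail : v.1 ∉ e.symm ((e univ).succAbove i) ∧ (v.2 : ℕ) = (e.symm ((e univ).succAbove i)).card)
    (hhead : v'.1 ∈ e.symm ((e ∅).succAbove j') ∧ (e.symm ((e ∅).succAbove j')).card = (v'.2 : ℕ) + 1)
    (hU : insert v.1 (e.symm ((e univ).succAbove i)) = e.symm ((e univ).succAbove i'))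
    (hT : e.symm ((e ∅).succAbove j) = (e.symm ((e ∅).succAbove j')).erase v'.1)
    (hle : (e.symm ((e ∅).succAbove j)).card ≤ (e.symm ((e univ).succAbove i)).card)
    (hB : ¬ e.symm ((e ∅).succAbove j) ⊆ e.symm ((e univ).succAbove i'))
    (d₁ d₂ : Fin n → Fin n)
    (h1inj : ∀ c c' : Fin n, (c : ℕ) ≤ (e.symm ((e univ).succAbove i)).card →
      (c' : ℕ) ≤ (e.symm ((e univ).succAbove i)).card → d₁ c = d₁ c' → c = c')
    (h1img : (univ.filter fun c : Fin n => (c : ℕ) ≤ (e.symm ((e univ).succAbove i)).card).image d₁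
      = e.symm ((e univ).succAbove i'))
    (h1top : d₁ v.2 = v.1)
    (h2inj : ∀ c c' : Fin n, (e.symm ((e ∅).succAbove j)).card ≤ (c : ℕ) →
      (e.symm ((e ∅).succAbove j)).card ≤ (c' : ℕ) → d₂ c = d₂ c' → c = c')
    (h2avoid : ∀ c : Fin n, (e.symm ((e ∅).succAbove j)).card ≤ (c : ℕ) → d₂ c ∉ e.symm ((e ∅).succAbove j))
    (h2bot : d₂ v'.2 = v'.1)
    (hdom1 : ∀ c : Fin n, (e.symm ((e ∅).succAbove j)).card ≤ (c : ℕ) →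
      (c : ℕ) ≤ (e.symm ((e univ).succAbove i)).card → ∃ c' : Fin n, (c' : ℕ) ≤ (c : ℕ) ∧ d₁ c' = d₂ c)
    (hdom2 : ∀ c : Fin n, (e.symm ((e ∅).succAbove j)).card ≤ (c : ℕ) →
      (c : ℕ) ≤ (e.symm ((e univ).succAbove i)).card →
        d₁ c ∈ e.symm ((e ∅).succAbove j) ∨ ∃ c' : Fin n, (c : ℕ) ≤ (c' : ℕ) ∧ d₂ c' = d₁ c) :
    A' v' i' j' = -A' v i j := by
  classical
  exact grenet_overlap_PQ_of_pointEval e hn hN A' htr htail hhead hU hT hle _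
    (fun i'' j'' v'' hrow hcol => grenet_overlapTerm_fwd e A' hsupp htail hhead hU hT hle hB d₁ d₂
      h1inj h1img h1top h2inj h2avoid h2bot hdom1 hdom2
      (fun w : Fin n × Fin n => ((w.2 : ℕ) ≤ (e.symm ((e univ).succAbove i)).card ∧ d₁ w.2 = w.1) ∨
        ((e.symm ((e ∅).succAbove j)).card ≤ (w.2 : ℕ) ∧ d₂ w.2 = w.1))
      (fun _ => Iff.rfl) i'' j'' v'' hrow hcol)


/-- **The core identity of an overlap block, backward-dominated design** (deliverable (D-PQ), type I>).
Let `(i, j, v)` be a TAIL entry (`v = (p, |S|)`, `p ∉ S = R i`, arc `S → U := S + p`) and `(i', j', v')`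
a HEAD entry (`v' = (p', |T|)`, `T = C j = C j' - p'`) of a homogeneous, rank-constrained tangent
direction at Grenet's pencil, of the same pair: `R i' = U`.  Suppose the pair OVERLAPS (`|T| ≤ |S|`)
with `T ⊄ U`, and let `(d₁, d₂)` be a backward-dominated overlap design through the two entries.  Then
`A'_{v'} i' j' = - A'_v i j`. [cite: Grenet2011, Thm. 1] -/
theorem grenet_overlap_PQ_of_design' (hn : n ≠ 0) (hN : 2 ^ n = N + 1)
    (A' : Fin n × Fin n → Matrix (Fin N) (Fin N) k)
    (htr : ((Grenet.repr k n e).adjugate * ∑ v, (X v : MvPolynomial (Fin n × Fin n) k) • (A' v).map C).trace = 0)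
    (hsupp : ∀ (w : Fin n × Fin n) (a b : Fin N), A' w a b ≠ 0 →
      (w.1 ∉ e.symm ((e univ).succAbove a) ∧ (w.2 : ℕ) = (e.symm ((e univ).succAbove a)).card) ∨
      (w.1 ∈ e.symm ((e ∅).succAbove b) ∧ (e.symm ((e ∅).succAbove b)).card = (w.2 : ℕ) + 1))
    {i j : Fin N} {v : Fin n × Fin n} {i' j' : Fin N} {v' : Fin n × Fin n}
    (htail : v.1 ∉ e.symm ((e univ).succAbove i) ∧ (v.2 : ℕ) = (e.symm ((e univ).succAbove i)).card)
    (hhead : v'.1 ∈ e.symm ((e ∅).succAbove j') ∧ (e.symm ((e ∅).succAbove j')).card = (v'.2 : ℕ) + 1)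
    (hU : insert v.1 (e.symm ((e univ).succAbove i)) = e.symm ((e univ).succAbove i'))
    (hT : e.symm ((e ∅).succAbove j) = (e.symm ((e ∅).succAbove j')).erase v'.1)
    (hle : (e.symm ((e ∅).succAbove j)).card ≤ (e.symm ((e univ).succAbove i)).card)
    (hB : ¬ e.symm ((e ∅).succAbove j) ⊆ e.symm ((e univ).succAbove i'))
    (d₁ d₂ : Fin n → Fin n)
    (h1inj : ∀ c c' : Fin n, (c : ℕ) ≤ (e.symm ((e univ).succAbove i)).card →
      (c' : ℕ) ≤ (e.symm ((e univ).succAbove i)).card → d₁ c = d₁ c' → c = c')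
    (h1img : (univ.filter fun c : Fin n => (c : ℕ) ≤ (e.symm ((e univ).succAbove i)).card).image d₁
      = e.symm ((e univ).succAbove i'))
    (h1top : d₁ v.2 = v.1)
    (h2inj : ∀ c c' : Fin n, (e.symm ((e ∅).succAbove j)).card ≤ (c : ℕ) →
      (e.symm ((e ∅).succAbove j)).card ≤ (c' : ℕ) → d₂ c = d₂ c' → c = c')
    (h2avoid : ∀ c : Fin n, (e.symm ((e ∅).succAbove j)).card ≤ (c : ℕ) → d₂ c ∉ e.symm ((e ∅).succAbove j))
    (h2bot : d₂ v'.2 = v'.1)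
    (hdom1 : ∀ c : Fin n, (e.symm ((e ∅).succAbove j)).card ≤ (c : ℕ) →
      (c : ℕ) ≤ (e.symm ((e univ).succAbove i)).card →
        d₂ c ∉ e.symm ((e univ).succAbove i') ∨ ∃ c' : Fin n, (c' : ℕ) ≤ (c : ℕ) ∧ d₁ c' = d₂ c)
    (hdom2 : ∀ c : Fin n, (e.symm ((e ∅).succAbove j)).card ≤ (c : ℕ) →
      (c : ℕ) ≤ (e.symm ((e univ).succAbove i)).card → ∃ c' : Fin n, (c : ℕ) ≤ (c' : ℕ) ∧ d₂ c' = d₁ c) :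
    A' v' i' j' = -A' v i j := by
  classical
  exact grenet_overlap_PQ_of_pointEval e hn hN A' htr htail hhead hU hT hle _
    (fun i'' j'' v'' hrow hcol => grenet_overlapTerm_bwd e A' hsupp htail hhead hU hT hle hB d₁ d₂
      h1inj h1img h1top h2inj h2avoid h2bot hdom1 hdom2
      (fun w : Fin n × Fin n => ((w.2 : ℕ) ≤ (e.symm ((e univ).succAbove i)).card ∧ d₁ w.2 = w.1) ∨
        ((e.symm ((e ∅).succAbove j)).card ≤ (w.2 : ℕ) ∧ d₂ w.2 = w.1))
      (fun _ => Iff.rfl) i'' j'' v'' hrow hcol)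


end OverlapDesign

end Summit.ValiantsHypothesis.Theorems.RigidityForcesSymmetry.GrenetGauge
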